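import Summits.AtomisticToContinuum.Crystallization.Theorems.FrustratedLawDichotomyTextureFlipGood

/-!
# FrustratedLawDichotomy · crux `AperiodicFrustratedLawGap` (stmt-AtomisticToContinuum-27623) — the ROOT-ONLY kill for near-perfect GOOD hosts
# (decomp-a2c lens-5 g111; critic r1712 (C4), r1713 (D))

`TexBall N y i R R₇ R₈ R₉` says in particular (second clause, at `j = i`) that the CENTRE is not `1/20`-good.  A root whose own first-shell window is
coherent with a template good with margin at `θ = 1/20` (`η₀d₀ + 4τ < (d₀ − 2τ)/20`, e.g. the unstrained fcc/hcp host at `τ = 1/128`: `0.032 < 0.049`)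
is ROBUSTLY `1/20`-good (`…TextureFlipGood.robustGood_of_template` at `θ = 1/20`), hence (engine `…TextureAllBad.good_transfer_core`, centred
version) the centre of any `7/10`-separated `y` two-way matched to the atoms is `1/20`-good: contradiction.  So for the near-perfect part of a host
net the incoherence of the root needs ONLY the window `‖x₀‖ + 13/10·d₀ + γ₀ + 4τ ≤ Rc` — no uniform verdict on a `ρ`-ball and NO dependence on the
texture radii `R₇ R₈ R₉`, which are bound INSIDE the crux hypothesis `(∃ R₇ R₈ R₉, ∀ᵐ μ ∂P, Appr μ R₇ R₈ R₉)` while the coherent class `C δ` of the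
texture door `…SignedLedgerTextureDoor` is fixed before `P`.

* ★ `gy_twentieth_centre_of_template` — configuration level: `Gy (1/20) N y i`.
* ★ `not_texBall_of_goodTemplate_centre` — hence `¬ TexBall N y i R R₇ R₈ R₉` for every `R₇ R₈ R₉` (`2d₀ + γ₀ + 2 ≤ R`).
* ★ `not_apprM_of_goodTemplate_root` — hence `¬ ApprM (count.restrict S) R₇ R₈ R₉` for a `δ`-separated `S ∋ 0` whose root window is coherent with a
  template good with margin `η₀d₀ + 41/10·τ < d₀/20` (the tolerance `ε` is chosen inside).
[folklore] throughout; no definitions, no `sorry`, no instances, no notation.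
-/

noncomputable section

namespace Summit.AtomisticToContinuum.Crystallization.Theorems.FrustratedLawDichotomyTextureFlipRoot

open Metric Set
open Literature.Geometry.DiscreteGeometry
open Summit.AtomisticToContinuum.Crystallization.Theorems.RepetitiveNetworkReductionRecurrentMember (Gy TexBall ApprM)
open Summit.AtomisticToContinuum.Crystallization.Theorems.FrustratedLawDichotomyTextureFlipGood (robustGood_of_template)

/-- ★ **Root-only GOOD kill, configuration level.**  `S` `δ`-separated with `p ∈ S` in the ball of a template site `x₀` GOOD WITH MARGIN AT `1/20`;
`y` `7/10`-separated and two-way `ε`-matched to `S` around `(y i, p)` up to radius `R`; numerics `100ε ≤ d₀ − 82τ − 20η₀d₀`, `5ε ≤ γ₀ − 46/10·τ`,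
`4ε < δ`, `4ε < 7/10`, `2d₀ + γ₀ + 2 ≤ R`.  Then the centre `y i` is `1/20`-good. [folklore] -/
theorem gy_twentieth_centre_of_template
    {S : Set (EuclideanSpace ℝ (Fin 3))} {δ : ℝ} (hS : ∀ x ∈ S, ∀ x' ∈ S, x ≠ x' → δ ≤ dist x x')
    {a : Finset (EuclideanSpace ℝ (Fin 3))} {τ Rc : ℝ} (hτ : 0 ≤ τ)
    (hC1 : ∀ x ∈ a, ∃ s, s ∈ closedBall x τ ∩ S) (hC1' : ∀ x ∈ a, (closedBall x τ ∩ S).Subsingleton)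
    (hC2 : ∀ s ∈ S, s ∈ closedBall (0 : EuclideanSpace ℝ (Fin 3)) Rc → ∃ x ∈ a, s ∈ closedBall x τ)
    {N : ℕ} {y : Fin N → EuclideanSpace ℝ (Fin 3)} {i : Fin N} {p x₀ : EuclideanSpace ℝ (Fin 3)} {R ε : ℝ}
    (hsepY : ∀ a b : Fin N, a ≠ b → (7 : ℝ) / 10 ≤ dist (y a) (y b))
    (hm1 : ∀ s ∈ S, dist s p ≤ R → ∃ b : Fin N, dist (y b - y i) (s - p) ≤ ε)
    (hm2 : ∀ b : Fin N, dist (y b) (y i) ≤ R → ∃ s ∈ S, dist (y b - y i) (s - p) ≤ ε)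
    (hp : p ∈ S) (hx₀ : x₀ ∈ a) (hpx : p ∈ closedBall x₀ τ)
    {Pat : Finset (EuclideanSpace ℝ (Fin 3))} (hwhich : Pat = fccKissingPattern ∨ Pat = hcpKissingPattern)
    {d₀ η₀ γ₀ : ℝ} {A : EuclideanSpace ℝ (Fin 3) →ₗᵢ[ℝ] EuclideanSpace ℝ (Fin 3)} {t₀ : ↥Pat → EuclideanSpace ℝ (Fin 3)}
    (hd₀ : 0 < d₀) (hη₀ : 0 ≤ η₀)
    (ht₀ : ∀ u : ↥Pat, t₀ u ∈ a ∧ ‖(t₀ u - x₀) - d₀ • A (u : EuclideanSpace ℝ (Fin 3))‖ ≤ η₀ * d₀)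
    (hnn₀ : ∀ z ∈ a, z ≠ x₀ → d₀ ≤ dist z x₀) (hnn₀' : ∃ z ∈ a, z ≠ x₀ ∧ dist z x₀ ≤ d₀)
    (hgap₀ : ∀ z ∈ a, z ≠ x₀ → dist z x₀ < 13 / 10 * d₀ + γ₀ → dist z x₀ ≤ 13 / 10 * d₀ - γ₀ ∧ z ∈ Set.range t₀)
    (hmarg₁ : η₀ * d₀ + 4 * τ < 1 / 20 * (d₀ - 2 * τ)) (hmarg₂ : 46 / 10 * τ < γ₀)
    (hRc : ‖x₀‖ + 13 / 10 * d₀ + γ₀ + 4 * τ ≤ Rc)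
    (hε0 : 0 < ε) (hεη : 100 * ε ≤ d₀ - 82 * τ - 20 * (η₀ * d₀)) (hεγ : 5 * ε ≤ γ₀ - 46 / 10 * τ)
    (hεδ : 4 * ε < δ) (hε7 : 4 * ε < 7 / 10) (hR : 2 * d₀ + γ₀ + 2 ≤ R) :
    Gy (1 / 20) N y i := by
  have hPat : Pat.Nonempty := by
    rcases hwhich with rfl | rfl
    · exact FrustratedLawDichotomyTextureFineShells.fccKissingPattern_nonempty
    · exact FrustratedLawDichotomyTextureFineShells.hcpKissingPattern_nonempty
  have hPatn : ∀ u ∈ Pat, ‖u‖ = 1 := by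
    rcases hwhich with rfl | rfl
    · exact fun u hu => norm_eq_one_of_mem_fccKissingPattern hu
    · exact fun u hu => norm_eq_one_of_mem_hcpKissingPattern hu
  have hPat1 : ∀ u ∈ Pat, ∀ u' ∈ Pat, u ≠ u' → 1 ≤ dist u u' := by
    rcases hwhich with rfl | rfl
    · exact fun u hu u' hu' h => one_le_dist_of_mem_fccKissingPattern hu hu' h
    · exact fun u hu u' hu' h => one_le_dist_of_mem_hcpKissingPattern hu hu' h
  obtain ⟨d, η, γ, t, hd_ge, hd_le, hηd, hγ, hd, hγ0, hη, ht, hnn₁, hnn₂, hgap⟩ :=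
    robustGood_of_template hτ hC1 hC1' hC2 hx₀ ⟨hpx, hp⟩ hPat hPatn hd₀ hη₀ ht₀ hnn₀ hnn₀' hgap₀ (by norm_num) (by norm_num)
      hmarg₁ hmarg₂ hRc
  have hj : dist (y i - y i) (p - p) ≤ ε := by rw [sub_self, sub_self, dist_self]; exact hε0.le
  have hεη' : 100 * ε ≤ d * (1 - 20 * η) := by
    have h1 : d * (1 - 20 * η) = d - 20 * (η * d) := by ring
    rw [h1, hηd]; linarith
  obtain ⟨e, he⟩ := FrustratedLawDichotomyTextureAllBad.good_transfer_core hS hsepY hm1 hm2 hp hj hPat hPatn hPat1 hd hη ht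
    hnn₁ hnn₂ hgap hε0 hεη' (by rw [hγ]; exact hεγ) hεδ hε7 (by linarith) rfl
  rcases hwhich with rfl | rfl
  · dsimp only [Gy]; exact ⟨A, Or.inl ⟨e, he⟩⟩
  · dsimp only [Gy]; exact ⟨A, Or.inr ⟨e, he⟩⟩

/-- ★ **Root-only GOOD kill against `TexBall`.**  With the data of `gy_twentieth_centre_of_template` and `0 ≤ R`, the matched ball is NOT
`TexBall N y i R R₇ R₈ R₉` (its second clause forbids a `1/20`-good centre) — for every `R₇ R₈ R₉`. [folklore] -/
theorem not_texBall_of_goodTemplate_centre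
    {S : Set (EuclideanSpace ℝ (Fin 3))} {δ : ℝ} (hS : ∀ x ∈ S, ∀ x' ∈ S, x ≠ x' → δ ≤ dist x x')
    {a : Finset (EuclideanSpace ℝ (Fin 3))} {τ Rc : ℝ} (hτ : 0 ≤ τ)
    (hC1 : ∀ x ∈ a, ∃ s, s ∈ closedBall x τ ∩ S) (hC1' : ∀ x ∈ a, (closedBall x τ ∩ S).Subsingleton)
    (hC2 : ∀ s ∈ S, s ∈ closedBall (0 : EuclideanSpace ℝ (Fin 3)) Rc → ∃ x ∈ a, s ∈ closedBall x τ)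
    {N : ℕ} {y : Fin N → EuclideanSpace ℝ (Fin 3)} {i : Fin N} {p x₀ : EuclideanSpace ℝ (Fin 3)} {R R₇ R₈ R₉ ε : ℝ}
    (hm1 : ∀ s ∈ S, dist s p ≤ R → ∃ b : Fin N, dist (y b - y i) (s - p) ≤ ε)
    (hm2 : ∀ b : Fin N, dist (y b) (y i) ≤ R → ∃ s ∈ S, dist (y b - y i) (s - p) ≤ ε)
    (hp : p ∈ S) (hx₀ : x₀ ∈ a) (hpx : p ∈ closedBall x₀ τ)
    {Pat : Finset (EuclideanSpace ℝ (Fin 3))} (hwhich : Pat = fccKissingPattern ∨ Pat = hcpKissingPattern)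
    {d₀ η₀ γ₀ : ℝ} {A : EuclideanSpace ℝ (Fin 3) →ₗᵢ[ℝ] EuclideanSpace ℝ (Fin 3)} {t₀ : ↥Pat → EuclideanSpace ℝ (Fin 3)}
    (hd₀ : 0 < d₀) (hη₀ : 0 ≤ η₀)
    (ht₀ : ∀ u : ↥Pat, t₀ u ∈ a ∧ ‖(t₀ u - x₀) - d₀ • A (u : EuclideanSpace ℝ (Fin 3))‖ ≤ η₀ * d₀)
    (hnn₀ : ∀ z ∈ a, z ≠ x₀ → d₀ ≤ dist z x₀) (hnn₀' : ∃ z ∈ a, z ≠ x₀ ∧ dist z x₀ ≤ d₀)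
    (hgap₀ : ∀ z ∈ a, z ≠ x₀ → dist z x₀ < 13 / 10 * d₀ + γ₀ → dist z x₀ ≤ 13 / 10 * d₀ - γ₀ ∧ z ∈ Set.range t₀)
    (hmarg₁ : η₀ * d₀ + 4 * τ < 1 / 20 * (d₀ - 2 * τ)) (hmarg₂ : 46 / 10 * τ < γ₀)
    (hRc : ‖x₀‖ + 13 / 10 * d₀ + γ₀ + 4 * τ ≤ Rc)
    (hε0 : 0 < ε) (hεη : 100 * ε ≤ d₀ - 82 * τ - 20 * (η₀ * d₀)) (hεγ : 5 * ε ≤ γ₀ - 46 / 10 * τ)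
    (hεδ : 4 * ε < δ) (hε7 : 4 * ε < 7 / 10) (hR : 2 * d₀ + γ₀ + 2 ≤ R) :
    ¬ TexBall N y i R R₇ R₈ R₉ := by
  intro htex
  have hR0 : dist (y i) (y i) ≤ R := by rw [dist_self]; linarith
  exact htex.2.1 i hR0 (gy_twentieth_centre_of_template hS hτ hC1 hC1' hC2 htex.1 hm1 hm2 hp hx₀ hpx hwhich hd₀ hη₀ ht₀ hnn₀ hnn₀'
    hgap₀ hmarg₁ hmarg₂ hRc hε0 hεη hεγ hεδ hε7 hR)

/-- ★ **Root-only GOOD kill against `ApprM` (rooted hard-core configurations).**  If `0 ∈ S`, `S` is `δ`-separated (`0 < δ`), and the root's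
window is coherent with a template good with margin at `1/20` (root in the ball of the good site `x₀`; margin `η₀d₀ + 41/10·τ < d₀/20`, e.g.
`η₀ = 0, τ = 1/128`: `0.032 < 0.05`), then `count.restrict S` is NOT `ApprM _ R₇ R₈ R₉`, for ANY radii: apply `ApprM` at the root with
`R := 2d₀ + γ₀ + 2` and a small enough `ε`. [folklore] -/
theorem not_apprM_of_goodTemplate_root
    {S : Set (EuclideanSpace ℝ (Fin 3))} {δ : ℝ} (hS : ∀ x ∈ S, ∀ x' ∈ S, x ≠ x' → δ ≤ dist x x') (hδ : 0 < δ) (h0 : (0 : EuclideanSpace ℝ (Fin 3)) ∈ S)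
    {a : Finset (EuclideanSpace ℝ (Fin 3))} {τ Rc : ℝ} (hτ : 0 ≤ τ)
    (hC1 : ∀ x ∈ a, ∃ s, s ∈ closedBall x τ ∩ S) (hC1' : ∀ x ∈ a, (closedBall x τ ∩ S).Subsingleton)
    (hC2 : ∀ s ∈ S, s ∈ closedBall (0 : EuclideanSpace ℝ (Fin 3)) Rc → ∃ x ∈ a, s ∈ closedBall x τ)
    {x₀ : EuclideanSpace ℝ (Fin 3)} (hx₀ : x₀ ∈ a) (h0x : (0 : EuclideanSpace ℝ (Fin 3)) ∈ closedBall x₀ τ)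
    {Pat : Finset (EuclideanSpace ℝ (Fin 3))} (hwhich : Pat = fccKissingPattern ∨ Pat = hcpKissingPattern)
    {d₀ η₀ γ₀ : ℝ} {A : EuclideanSpace ℝ (Fin 3) →ₗᵢ[ℝ] EuclideanSpace ℝ (Fin 3)} {t₀ : ↥Pat → EuclideanSpace ℝ (Fin 3)}
    (hd₀ : 0 < d₀) (hη₀ : 0 ≤ η₀)
    (ht₀ : ∀ u : ↥Pat, t₀ u ∈ a ∧ ‖(t₀ u - x₀) - d₀ • A (u : EuclideanSpace ℝ (Fin 3))‖ ≤ η₀ * d₀)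
    (hnn₀ : ∀ z ∈ a, z ≠ x₀ → d₀ ≤ dist z x₀) (hnn₀' : ∃ z ∈ a, z ≠ x₀ ∧ dist z x₀ ≤ d₀)
    (hgap₀ : ∀ z ∈ a, z ≠ x₀ → dist z x₀ < 13 / 10 * d₀ + γ₀ → dist z x₀ ≤ 13 / 10 * d₀ - γ₀ ∧ z ∈ Set.range t₀)
    (hmarg₁ : η₀ * d₀ + 41 / 10 * τ < 1 / 20 * d₀) (hmarg₂ : 46 / 10 * τ < γ₀)
    (hRc : ‖x₀‖ + 13 / 10 * d₀ + γ₀ + 4 * τ ≤ Rc) (R₇ R₈ R₉ : ℝ) :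
    ¬ ApprM (MeasureTheory.Measure.count.restrict S : MeasureTheory.Measure (EuclideanSpace ℝ (Fin 3))) R₇ R₈ R₉ := by
  intro happr
  have hmem : ∀ q : EuclideanSpace ℝ (Fin 3),
      (MeasureTheory.Measure.count.restrict S : MeasureTheory.Measure (EuclideanSpace ℝ (Fin 3))) {q} ≠ 0 ↔ q ∈ S :=
    fun q => Literature.Probability.Process.count_restrict_singleton_ne_zero_iff S q
  -- a tolerance meeting every engine numeric
  set ε : ℝ := min (min (min ((d₀ - 82 * τ - 20 * (η₀ * d₀)) / 100) ((γ₀ - 46 / 10 * τ) / 5)) (δ / 5)) (1 / 10) with hε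
  have hε0 : 0 < ε := lt_min (lt_min (lt_min (by linarith) (by linarith)) (by linarith)) (by norm_num)
  have hεη : 100 * ε ≤ d₀ - 82 * τ - 20 * (η₀ * d₀) := by
    have h1 : ε ≤ (d₀ - 82 * τ - 20 * (η₀ * d₀)) / 100 := by
      rw [hε]; exact ((min_le_left _ _).trans (min_le_left _ _)).trans (min_le_left _ _)
    linarith
  have hεγ : 5 * ε ≤ γ₀ - 46 / 10 * τ := by
    have h1 : ε ≤ (γ₀ - 46 / 10 * τ) / 5 := by
      rw [hε]; exact ((min_le_left _ _).trans (min_le_left _ _)).trans (min_le_right _ _)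
    linarith
  have hεδ : 4 * ε < δ := by
    have h1 : ε ≤ δ / 5 := by rw [hε]; exact (min_le_left _ _).trans (min_le_right _ _)
    linarith
  have hε7 : 4 * ε < 7 / 10 := by
    have h1 : ε ≤ 1 / 10 := by rw [hε]; exact min_le_right _ _
    linarith
  obtain ⟨N, y, i, htex, hm1, hm2⟩ := happr 0 ((hmem 0).2 h0) (2 * d₀ + γ₀ + 2) ε hε0
  have hm1' : ∀ s ∈ S, dist s 0 ≤ 2 * d₀ + γ₀ + 2 → ∃ b : Fin N, dist (y b - y i) (s - 0) ≤ ε :=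
    fun s hs => hm1 s ((hmem s).2 hs)
  have hm2' : ∀ b : Fin N, dist (y b) (y i) ≤ 2 * d₀ + γ₀ + 2 → ∃ s ∈ S, dist (y b - y i) (s - 0) ≤ ε := fun b hb => by
    obtain ⟨s, hs, h⟩ := hm2 b hb
    exact ⟨s, (hmem s).1 hs, h⟩
  have hmarg₁' : η₀ * d₀ + 4 * τ < 1 / 20 * (d₀ - 2 * τ) := by linarith
  exact not_texBall_of_goodTemplate_centre hS hτ hC1 hC1' hC2 hm1' hm2' h0 hx₀ h0x hwhich hd₀ hη₀ ht₀ hnn₀ hnn₀' hgap₀ hmarg₁' hmarg₂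
    hRc hε0 hεη hεγ hεδ hε7 le_rfl htex

end Summit.AtomisticToContinuum.Crystallization.Theorems.FrustratedLawDichotomyTextureFlipRoot

end
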